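import Summits.AtomisticToContinuum.BoseEinsteinCondensation.Theses.BECSectorPoincareTwoScale

/-!
# Route `BECSectorPoincareTwoScale`, support item `CruxesToLandauSectorBound`
(stmt-AtomisticToContinuum-14110)

Glue to the route target by name: `TwoScaleReduction → TorusHyperuniformity → LandauSectorBound`.

The rank-2 crux `TwoScaleReduction` is, for each admissible potential `v`, literally the implication
"body of `TorusHyperuniformity` at `v` → body of `LandauSectorBound` at `v`", and the rank-3 crux
`TorusHyperuniformity` supplies its hypothesis; so the target `LandauSectorBound` follows pointwise
in `v`. Pure logic; no mathematics.
-/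

namespace Summit.AtomisticToContinuum.BoseEinsteinCondensation.Theorems

open Summit.AtomisticToContinuum.BoseEinsteinCondensation.Theses.BECSectorPoincareTwoScale

/-- **`CruxesToLandauSectorBound` holds** (settles stmt-AtomisticToContinuum-14110, exact route decl
of `BECSectorPoincareTwoScale`): `TwoScaleReduction → TorusHyperuniformity → LandauSectorBound`.
For an admissible `v`, `TwoScaleReduction v hv` is the implication from the hyperuniformity body to
the Landau sector-floor body, and `TorusHyperuniformity v hv` is that hypothesis; compose. -/
theorem cruxesToLandauSectorBound_proof :
    Summit.AtomisticToContinuum.BoseEinsteinCondensation.Theses.BECSectorPoincareTwoScale.CruxesToLandauSectorBound := by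
  unfold CruxesToLandauSectorBound
  intro hTS hHU v hv
  exact hTS v hv (hHU v hv)

end Summit.AtomisticToContinuum.BoseEinsteinCondensation.Theorems
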